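import Literature.Algebra.EuclideanLattices.MRGapCVPRunD
import Literature.Probability.Distributions.IndepProductLawDistance
import HarnessLib

/-!
# The run of `W` in sampling order with an arbitrary sampler, its identification with `wRunD`, and its stability in the sampler

Topic `Algebra/EuclideanLattices` (family `pqc`). Micciancio–Regev 2007, Thm. 5.23, step (2) (authors' version
p. 29), in the dual-grid model of `DualGridAttemptSuccess` / `MRGapCVPRunD`. A MACHINE runs `W(B, S)` in sampling
order — `m` integer noises `Kᵢ` (coordinates i.i.d. from a one-dimensional sampler law `D`, in the analysis the
exact `D_{ℤ,Ns,0}`), `m` coin boxes `κᵢ`, the query `A = Amat K κ`, the oracle's answer `z`, the abort rule, the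
output `u = uVec K κ z ∈ ℤⁿ` — while the analysis (`wRunD`, `MRGapCVPBlocksD`) is phrased on `experimentD` (classes
first). This file bridges the two and isolates the only place where the machine's sampler enters:

* `wAttemptWith D O β ℓ` (definition with body) — the run in sampling order with sampler law `D`, values in
  `Option ℤⁿ`; `wAttempt` — the same with the exact `D_{ℤ,Ns,0}` (`DualGridAttemptSuccess.naturalAttemptWith`
  with the abort rule of `W` in place of the `IncGDD` verification);
* `toW` — reading an integer vector as a witness (`some ⟨u, _⟩` iff `u ∈ (Λ*)*`, always the case for `uVec`);
* `map_wAttempt_eq` — **sampling order = the analysed run**: `(wAttempt O s β ℓ).map (·.bind toW) = wRunD hB O s β ℓ`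
  (port of `DualGridAttemptSuccess.map_naturalAttempt_eq`: Lemma 5.7, second claim, `indepLaw_map_gsOf_eq`);
* `tvDist_gridNoiseWith_le`, `tvDist_wAttemptWith_le` — **stability in the sampler**:
  `Δ(wAttemptWith D₁, wAttemptWith D₂) ≤ m·n·Δ(D₁, D₂)` (hybrid bound over the `mn` coordinates, then kernel
  contraction through boxes, query, oracle and the deterministic post-processing).

All proved; no named fact.

## References

* D. Micciancio, O. Regev, *Worst-case to average-case reductions based on Gaussian measures*,
  SIAM J. Comput. 37 (2007) 267–302; authors' version, proof of Thm. 5.23, step (2) (p. 29), Lemma 5.7 (p. 20).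
* O. Goldreich, *Foundations of Cryptography I*, CUP 2001, §3.2 (statistical distance: hybrid argument and
  data processing) [Goldreich2001].
-/

noncomputable section

open scoped Classical ENNReal Real

namespace Literature.Algebra.EuclideanLattices

open Module Submodule Matrix GSInverse Finset Literature.Probability.Distributions PMF MeasureTheory
  Literature.Computability.Cryptography Literature.Computability.Cryptography.SIS

namespace DualGrid

variable {n : ℕ} (B : Matrix (Fin n) (Fin n) ℤ) (N : ℕ) (S : Fin n → Fin n → ℤ) [NeZero N] {m : ℕ}

/-! ### The run in sampling order -/

/-- **One run of `W(B, S)` in sampling order with an arbitrary one-dimensional sampler law `D`**: noises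
`Kᵢ ∼ ⨂ D` (zero shift), coin boxes `κᵢ`, query `A = Amat K κ`, answer `z ∼ O A`; keep `u = uVec K κ z` iff `z`
is an `SIS′` solution of `A`. [cite: MicciancioRegev2007, Thm. 5.23 (proof, step (2), p. 29)] -/
def wAttemptWith {q : ℕ} (D : PMF ℤ) (O : Matrix (Fin n) (Fin m) (ZMod q) → PMF (Fin m → ℤ)) (β : ℝ) (ℓ : ℕ) :
    PMF (Option (Fin n → ℤ)) :=
  (indepLaw m fun _ => gridNoiseWith D (0 : Fin n → ℤ)).bind fun K =>
    (indepLaw m fun _ => boxLaw n ℓ).bind fun κ =>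
      (O (Amat B N S q K κ)).map fun z => if IsSolution' (Amat B N S q K κ) β z then some (uVec B N S q K κ z) else none

/-- **The run in sampling order with the exact sampler `D_{ℤ,Ns,0}`.** [cite: MicciancioRegev2007, Thm. 5.23 (proof, step (2), p. 29)] -/
def wAttempt {q : ℕ} (O : Matrix (Fin n) (Fin m) (ZMod q) → PMF (Fin m → ℤ)) (s β : ℝ) (ℓ : ℕ) : PMF (Option (Fin n → ℤ)) :=
  wAttemptWith B N S (discreteGaussianInt ((N : ℝ) * s) 0) O β ℓ

omit [NeZero N] in
/-- `wAttempt` unfolds to the noise/box/oracle binds with `gridNoise`. [folklore] -/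
theorem wAttempt_eq {q : ℕ} (O : Matrix (Fin n) (Fin m) (ZMod q) → PMF (Fin m → ℤ)) (s β : ℝ) (ℓ : ℕ) :
    wAttempt B N S O s β ℓ = (indepLaw m fun _ => gridNoise N s (0 : Fin n → ℤ)).bind fun K =>
      (indepLaw m fun _ => boxLaw n ℓ).bind fun κ =>
        (O (Amat B N S q K κ)).map fun z => if IsSolution' (Amat B N S q K κ) β z then some (uVec B N S q K κ z) else none :=
  rfl

/-- **Reading an integer vector as a witness**: `some ⟨u, _⟩` if `u ∈ (Λ*)*`, else `none` (never, for the
outputs of `W`). [folklore] -/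
def toW (v : Fin n → ℤ) : Option (WLat B) :=
  if h : intVecToEuclidean n v ∈ WLat B then some ⟨_, h⟩ else none

variable {B N S}

/-- `toW` of a vector of `Λ`. [folklore] -/
theorem toW_of_mem [IsZLattice ℝ (dualLat B)] {v : Fin n → ℤ} (hv : intVecToEuclidean n v ∈ dualLat B) :
    toW B v = some ⟨intVecToEuclidean n v, mem_WLat_of_mem hv⟩ := by
  rw [toW, dif_pos (mem_WLat_of_mem hv)]

/-! ### Sampling order = the analysed run -/

/-- **The run in sampling order, read as witnesses, is `wRunD`** (Lemma 5.7, second claim, for all `m` runs: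
the pairs `(cᵢ, yᵢ)` from independent noises are `(⨂ offsetLawD) ⋉ condLawD`; then the boxes and the oracle
commute with the `y`-stage). [cite: MicciancioRegev2007, Thm. 5.23 (proof, step (2), p. 29) with Lemma 5.7] -/
theorem map_wAttempt_eq [IsZLattice ℝ (dualLat B)] (hB : B.det ≠ 0) (hS : ∀ j, intVecToEuclidean n (S j) ∈ dualLat B)
    {q : ℕ} (O : Matrix (Fin n) (Fin m) (ZMod q) → PMF (Fin m → ℤ)) {s : ℝ} (hs : 0 < s) (β : ℝ) (ℓ : ℕ) :
    (wAttempt B N S O s β ℓ).map (fun o => o.bind (toW B)) = wRunD B N S hB O s β ℓ := by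
  -- the post-processing of the analysed run, as a function of `ω`
  set post : (((Fin m → Grp B N) × (Fin m → Fin n → ℤ)) × (Matrix (Fin n) (Fin m) (ZMod q) × (Fin m → ℤ))) × (Fin m → dualLat B) →
      Option (WLat B) := fun ω => if h : IsSolution' ω.1.2.1 β ω.1.2.2 ∧ outputD B N S q ω ∈ WLat B then some ⟨_, h.2⟩ else none
    with hpost
  -- Step 1: sampling order through the pairs `(cᵢ, yᵢ) = gsOf Kᵢ`
  have hstep : ∀ (K : Fin m → Fin n → ℤ) (κ : Fin m → Fin n → ℤ) (z : Fin m → ℤ),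
      (if IsSolution' (Amat B N S q K κ) β z then some (uVec B N S q K κ z) else none).bind (toW B) =
        post ((((fun i => (gsOf (N := N) hB (K i)).1), κ), (queryMatrixD B N S q (fun i => (gsOf (N := N) hB (K i)).1) κ, z)),
          fun i => (gsOf (N := N) hB (K i)).2) := by
    intro K κ z
    rw [hpost]
    dsimp only
    rw [← Amat_eq_queryMatrixD hB]
    by_cases hsol : IsSolution' (Amat B N S q K κ) β z
    · rw [if_pos hsol, Option.bind_some, toW_of_mem (uVec_mem hS q K κ z),
        dif_pos ⟨hsol, mem_WLat_of_mem (outputD_mem hS q _)⟩]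
      congr 1
      exact Subtype.ext (coe_uVec_eq_outputD hB q K κ _ z)
    · rw [if_neg hsol, Option.bind_none, dif_neg (fun h => hsol h.1)]
  have h1 : (wAttempt B N S O s β ℓ).map (fun o => o.bind (toW B)) =
      ((indepLaw m fun i => (gridNoise N s ((fun _ => (0 : Fin n → ℤ)) i)).map (gsOf (N := N) hB)).bind fun cy =>
        (indepLaw m fun _ => boxLaw n ℓ).bind fun κ =>
          (O (queryMatrixD B N S q (fun i => (cy i).1) κ)).map fun z =>
            ((((fun i => (cy i).1), κ), (queryMatrixD B N S q (fun i => (cy i).1) κ, z)), fun i => (cy i).2)).map post := by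
    rw [← indepLaw_map_pi m _ (fun _ => gsOf (N := N) hB), PMF.bind_map, PMF.map_bind, wAttempt_eq, PMF.map_bind]
    refine congrArg (indepLaw m fun _ => gridNoise N s (0 : Fin n → ℤ)).bind (funext fun K => ?_)
    simp only [Function.comp_apply, PMF.map_bind]
    refine congrArg (indepLaw m fun _ => boxLaw n ℓ).bind (funext fun κ => ?_)
    rw [PMF.map_comp, PMF.map_comp, ← Amat_eq_queryMatrixD hB]
    congr 1
    funext z
    simp only [Function.comp_apply]
    rw [hstep K κ z, ← Amat_eq_queryMatrixD hB]
  rw [h1, indepLaw_map_gsOf_eq hB hs (fun _ => (0 : Fin n → ℤ)), PMF.bind_bind, wRunD, experimentD, PMF.bind_bind, PMF.map_bind,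
    PMF.map_bind]
  refine congrArg (indepLaw m fun i => offsetLawD B N hB s ((fun _ => (0 : Fin n → ℤ)) i)).bind (funext fun c => ?_)
  rw [PMF.bind_map, PMF.bind_map]
  change (((condLawD B N s (fun _ => 0) c).bind fun y => (indepLaw m fun _ => boxLaw n ℓ).bind fun κ =>
      (O (queryMatrixD B N S q c κ)).map fun z => (((c, κ), (queryMatrixD B N S q c κ, z)), y)).map post) =
    ((indepLaw m fun _ => boxLaw n ℓ).bind fun κ => (condLawD B N s (fun _ => 0) c).bind fun y =>
      ((PMF.pure (queryMatrixD B N S q c κ)).bind fun A => (O A).map (Prod.mk A)).map fun az => (((c, κ), az), y)).map post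
  rw [PMF.bind_comm]
  congr 1
  refine congrArg (indepLaw m fun _ => boxLaw n ℓ).bind (funext fun κ => ?_)
  refine congrArg (condLawD B N s (fun _ => 0) c).bind (funext fun y => ?_)
  rw [PMF.pure_bind, PMF.map_comp]
  rfl

/-! ### Stability in the sampler -/

/-- **Hybrid bound for the noises**: `Δ(gridNoiseWith D₁ T, gridNoiseWith D₂ T) ≤ n·Δ(D₁, D₂)`. [cite: Goldreich2001, §3.2.3 (hybrid argument)] -/
theorem tvDist_gridNoiseWith_le (D₁ D₂ : PMF ℤ) (T : Fin n → ℤ) :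
    (gridNoiseWith D₁ T).tvDist (gridNoiseWith D₂ T) ≤ n * D₁.tvDist D₂ := by
  rw [gridNoiseWith, gridNoiseWith]
  refine (tvDist_map_le_holds _ _ _).trans ?_
  refine (tvDist_indepLaw_le n _ _).trans (le_of_eq ?_)
  rw [Finset.sum_const, Finset.card_univ, Fintype.card_fin, nsmul_eq_mul]

omit [NeZero N] in
/-- **Stability of the run of `W` in its sampler**: `Δ(wAttemptWith D₁, wAttemptWith D₂) ≤ m·n·Δ(D₁, D₂)` — the
`mn` noise coordinates are replaced one at a time (hybrid bound), and everything after the noises (boxes, query,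
oracle, abort rule, output) is one Markov kernel (data processing).
[cite: Goldreich2001, §3.2 (Thm. 3.2.6 and Exercise 10: hybrid argument, data processing)] -/
theorem tvDist_wAttemptWith_le {q : ℕ} (D₁ D₂ : PMF ℤ) (O : Matrix (Fin n) (Fin m) (ZMod q) → PMF (Fin m → ℤ)) (β : ℝ) (ℓ : ℕ) :
    (wAttemptWith B N S D₁ O β ℓ).tvDist (wAttemptWith B N S D₂ O β ℓ) ≤ m * (n * D₁.tvDist D₂) := by
  rw [wAttemptWith, wAttemptWith]
  refine (tvDist_bind_left_le _ _ _).trans ?_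
  refine (tvDist_indepLaw_le m _ _).trans ?_
  calc ∑ _i : Fin m, (gridNoiseWith D₁ (0 : Fin n → ℤ)).tvDist (gridNoiseWith D₂ 0) ≤ ∑ _i : Fin m, n * D₁.tvDist D₂ :=
        Finset.sum_le_sum fun i _ => tvDist_gridNoiseWith_le D₁ D₂ 0
    _ = m * (n * D₁.tvDist D₂) := by rw [Finset.sum_const, Finset.card_univ, Fintype.card_fin, nsmul_eq_mul]

omit [NeZero N] in
/-- **Stability of the witnesses read from the run**: `Δ` does not increase under `·.bind toW`. [cite: Goldreich2001, §3.2 (data processing)] -/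
theorem tvDist_map_toW_le {q : ℕ} (D₁ D₂ : PMF ℤ) (O : Matrix (Fin n) (Fin m) (ZMod q) → PMF (Fin m → ℤ)) (β : ℝ) (ℓ : ℕ) :
    ((wAttemptWith B N S D₁ O β ℓ).map (fun o => o.bind (toW B))).tvDist ((wAttemptWith B N S D₂ O β ℓ).map (fun o => o.bind (toW B))) ≤
      m * (n * D₁.tvDist D₂) :=
  (tvDist_map_le_holds _ _ _).trans (tvDist_wAttemptWith_le D₁ D₂ O β ℓ)

end DualGrid

end Literature.Algebra.EuclideanLattices

end
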